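import Summits.ResolutionOfSingularities.ResolutionOfSingularities.Theorems.MarkedTransferCampaignW46ThreefoldsResolved
import Summits.ResolutionOfSingularities.ResolutionOfSingularities.Theorems.MarkedTransferCampaignW46ProcrastinationNabla
import Literature.AlgebraicGeometry.Resolution.BlowupsExistence
import Literature.AlgebraicGeometry.Resolution.RegularBlowup
import HarnessLib

/-!
# [OURS · L1 W4.6 rung (ii)] STEP EXISTENCE IS A KERNEL FACT WHEN THE TERMINAL PLAT IS IRREDUCIBLE (perfect base field), and
# then the whole-∇ reduction resolves every state by an `E`-permissible LSB (proofs)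

Cell res-hironaka, LADDER-RESOLUTION rung L (D-0089), slot W4.6, rung (ii); seat res-L1-s46-pv-3 (gen 2). Host route
MarkedTransfer, host item `HypersurfaceOrderReductionDimLeThree` (stmt-16156); `--kind proof --supports` it. Companion of
`…ThreefoldsProgress` v2 (`NablaStepExists`, `NablaIrreducible`), `…ThreefoldsResolved` (exhaustion ⇒ LSB), `…ThreefoldsRegime`,
`…StringReadingReductionSing` and res-L1-s46-pv-1's `…ProcrastinationNabla` (`isNablaComponent_of_nabla_eq`; the one-point engine
`exists_procrastinatingStep_at`, of which the engine below is the whole-∇ sibling).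

HONEST FRAMING. Everything below is OURS: kernel theorems over the campaign shapes and the tree's blow-up library (existence
of blow-ups `exists_isBlowup`, regularity `IsBlowup.isRegular_of_isRegular_subscheme` (Liu 8.1.19 (a)), smoothness over a
perfect field `smooth_of_isRegular_of_perfectField` (Matsumura §30)). NOTHING here is a statement of H. Hironaka's manuscript
(2017-03-23, [Hironaka2017]) and nothing asserts that any statement of it holds; the résumé's Def. 15.12 fields and all shapes
are HYPOTHESES. AI review is weaker than expert review.

## What

* THE WHOLE-∇ ENGINE (`Resume.exists_wholeStepNabla`, perfect `K`): at a state with a résumé `R` whose terminal plat `∇(E)` is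
  IRREDUCIBLE, the literal centre rule admits `D = ∇(E)` (smooth by the résumé's Def. 15.12 hypothesis field), the blow-up
  `π : Z′ → Z` along it EXISTS (tree), `Z′` is again an ambient datum over `K` (integral: the centre misses the generic point
  since `∇ ⊆ Sing(E)` and `E` is standard; regular: Liu; smooth: perfect field; quasi-compact: proper), and the resulting
  step is a ∇-step with centre all of `∇(E)`. Hence `NablaIrreducible N Rd Rg → NablaStepExists N Rd Rg`
  (`nablaStepExists_of_nablaIrreducible`) — the progress hypothesis of `…ThreefoldsResolved` DISCHARGED in this sub-case.
* When every terminal plat is irreducible, every ∇-centred run is a whole-∇ run, so `TerminatesWhole → TerminatesNabla`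
  (`terminatesNabla_of_terminatesWhole_of_nablaIrreducible`): the WHOLE-∇ reduction (four shapes — Eq. (127), `m′ ≤ m`, top
  stratum, monotonicity at singular points; no Eq. (128), no component measure) already yields the registered shape.
* RUNG (ii), IRREDUCIBLE-∇ SUB-CASE: `TerminatesWholeII → NablaIrreducibleII → ResumesCover … → every standard regime-(ii)
  state is resolved by an E-permissible LSB` (`exists_isPermissibleLSB_of_regimeII_irred`), the same from four `σ`-shapes of
  any string reading (`…_of_shapes_irred`), and the host-words form `exists_isPermissibleLSB_hostState_irred` (Γ-free order
  reduction of every input `(k, X, I, m)` of stmt-16156, `K` perfect) — remaining hypotheses are ONLY about the résumés of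
  the named `N` (four shapes, irreducible terminal plats, coverage).

References: `…ThreefoldsProgress` v2; `…ThreefoldsResolved` (p487519); pv-1 `…ProcrastinationNabla` (p475556) /
`…LiteralCentreProcrastination` (p472353); tree `BlowupsExistence`, `RegularBlowup`, `SmoothOfRegularPerfectField`
[Liu2002, Matsumura1987, GortzWedhorn2020]. H. Hironaka, ms. 2017-03-23, Th. 16.6 (4) p.84 l.29–32, Def. 15.12 p.80 l.36 –
p.81 l.4, §16.3 p.87 — scope only, under adjudication, not cited as fact. [Hironaka2017]
-/

noncomputable section

set_option linter.dupNamespace false -- mandated namespace of this single-conjunct summit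

open CategoryTheory AlgebraicGeometry TopologicalSpace

namespace Summit.ResolutionOfSingularities.ResolutionOfSingularities.Theorems

namespace CampaignW46

open Literature.AlgebraicGeometry.Resolution
open Literature.AlgebraicGeometry.Hironaka2017
open Literature.AlgebraicGeometry.Hironaka2017.S02Preliminaries
open Literature.AlgebraicGeometry.Hironaka2017.Datum
open Literature.AlgebraicGeometry.Hironaka2017.S15ARSchemes
open Literature.AlgebraicGeometry.Hironaka2017.S16Proof

universe u

variable {n : ℕ} {p : ℕ} [Fact p.Prime] {K : Type u} [Field K] [CharP K p]

/-! ## The whole-∇ engine: blowing up an irreducible terminal plat -/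

section Engine

variable {N : Notions.{u} n} {A : AmbientDatum p K} {E : IdealExponent A.Z}

/-- The literal centre rule admits the WHOLE terminal plat when it is irreducible: `∇(E) ⊆ ∇(E)`, irreducible by hypothesis,
smooth over `K` by the résumé's Def. 15.12 hypothesis field `nabla_smooth`. [folklore] -/
theorem Resume.isCentre_nabla (R : Resume N A E) (hirr : IsIrreducible (R.nabla : Set A.Z)) : IsCentre R R.nabla := by
  have hN : IsSmoothClosedNonempty A.hom (R.𝒴.nabla R.T) := R.nabla_smooth
  obtain ⟨hNcl, -, hNsm⟩ := hN
  exact ⟨subset_rfl, hirr, hNsm⟩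

/-- The terminal plat of a résumé is a PROPER closed subset: its ideal is non-zero (`∇(E) ⊆ Sing(E)` misses the generic
point of the integral `Z`, `E` being standard by the résumé's row-019 standardness). [folklore] -/
theorem Resume.vanishingIdeal_nabla_ne_bot (R : Resume N A E) : Scheme.IdealSheafData.vanishingIdeal R.nabla ≠ ⊥ := by
  obtain ⟨-, -, hint⟩ := ambientZ_std A
  haveI := hint
  have hE : E.IsStandard := R.mti_isStandard.1
  intro h
  have hgen : genericPoint A.Z ∈ (R.nabla : Set A.Z) := by
    rw [← Scheme.IdealSheafData.coe_support_vanishingIdeal R.nabla, h, Scheme.IdealSheafData.support_bot]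
    trivial
  have hsing : (E.b : ℕ∞) ≤ idealOrder E.J (genericPoint A.Z) := R.nabla_subset_sing hgen
  have hb : (1 : ℕ∞) ≤ (E.b : ℕ∞) := by exact_mod_cast (hE.2 : 1 ≤ E.b)
  exact not_mem_support_genericPoint hE.1 ((one_le_idealOrder_iff E.J _).mp (hb.trans hsing))

variable [PerfectField K]

/-- **THE WHOLE-∇ ENGINE (perfect base field).** At a state with a résumé `R` whose terminal plat `∇(E)` is irreducible
there IS a ∇-step with centre ALL of `∇(E)`: the blow-up of `Z` along `∇(E)` exists (tree `exists_isBlowup`), is integral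
(non-zero centre ideal), regular (regular centre, Liu 8.1.19 (a)), hence smooth over the perfect `K` (Matsumura §30) and
quasi-compact (proper) — an ambient datum — and the step is admitted by the literal rule (`Resume.isCentre_nabla`) with
centre a (the) component of `∇(E)`. [cite: Liu2002, Thm. 8.1.19 (a)] -/
theorem Resume.exists_wholeStepNabla (R : Resume N A E) (hirr : IsIrreducible (R.nabla : Set A.Z)) :
    ∃ (A' : AmbientDatum p K) (s : StepNabla R A'), (s.toStep.D : Set A.Z) = (R.nabla : Set A.Z) := by
  haveI := A.smooth
  haveI := A.quasiCompact
  obtain ⟨hln, hZreg, hint⟩ := ambientZ_std A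
  haveI := hln
  haveI := hint
  have hcentre : IsCentre R R.nabla := R.isCentre_nabla hirr
  have hreg : Scheme.IsRegular (Scheme.IdealSheafData.vanishingIdeal R.nabla).subscheme := hcentre.isRegular_subscheme
  obtain ⟨Z', π, hπ⟩ := exists_isBlowup A.Z (Scheme.IdealSheafData.vanishingIdeal R.nabla)
  haveI : IsIntegral Z' := hπ.isIntegral R.vanishingIdeal_nabla_ne_bot
  haveI : IsProper π := hπ.isProper
  have hZ'reg : Scheme.IsRegular Z' := hπ.isRegular_of_isRegular_subscheme hZreg hreg
  haveI : Smooth (π ≫ A.hom) := smooth_of_isRegular_of_perfectField _ hZ'reg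
  let A' : AmbientDatum p K :=
    { Z := Z', hom := π ≫ A.hom, irreducible := inferInstance, smooth := inferInstance, quasiCompact := inferInstance }
  let s : Step R A' := { D := R.nabla, centre := hcentre, π := π, hom_eq := rfl, blowup := hπ }
  exact ⟨A', ⟨s, isNablaComponent_of_nabla_eq hcentre rfl⟩, rfl⟩

end Engine

/-! ## Consequences: step existence, and ∇-centred = whole-∇ when the plats are irreducible -/

section Consequences

variable {N : Notions.{u} n} {Rd : Reading p K N} {Rg : Regime p K}

/-- **STEP EXISTENCE DISCHARGED in the irreducible-∇ sub-case** (perfect `K`): `NablaIrreducible N Rd Rg →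
NablaStepExists N Rd Rg`. [folklore] -/
theorem nablaStepExists_of_nablaIrreducible [PerfectField K] (h : NablaIrreducible N Rd Rg) : NablaStepExists N Rd Rg := by
  intro A E R hRg hRd
  obtain ⟨A', s, -⟩ := R.exists_wholeStepNabla (h A E R hRg hRd)
  exact ⟨A', ⟨s⟩⟩

/-- Pure logic: when every terminal plat in the regime is irreducible, the centre of every ∇-step is the whole plat (a
component of an irreducible set is the set), so every ∇-centred run is a whole-∇ run and `TerminatesWhole → TerminatesNabla`.
[folklore] -/
theorem terminatesNabla_of_terminatesWhole_of_nablaIrreducible (hW : TerminatesWhole N Rd Rg)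
    (h : NablaIrreducible N Rd Rg) : TerminatesNabla N Rd Rg := by
  intro r hRg
  refine hW r.toRun (fun k => ?_) hRg
  exact ((r.step k).component.maximal _ (h _ _ _ (hRg k) (r.reads k)) (r.step k).component.subset_nabla
    subset_rfl).symm

end Consequences

/-! ## Rung (ii), irreducible-∇ sub-case: resolution by an LSB from the whole-∇ shapes -/

section RungII

variable {N : Notions.{u} n} {Rd : Reading p K N}

/-- **RUNG (ii), IRREDUCIBLE TERMINAL PLATS (perfect `K`).** `TerminatesWholeII N Rd`, irreducibility of the terminal plats
of the regime-(ii) résumés, and résumé coverage of the standard unresolved regime-(ii) states imply that every standard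
threefold-hypersurface state is resolved by an `E`-permissible LSB — step existence being a kernel fact here. [folklore] -/
theorem exists_isPermissibleLSB_of_regimeII_irred [PerfectField K] (hW : TerminatesWholeII N Rd)
    (hI : NablaIrreducibleII N Rd) (hC : ResumesCover N Rd fun A E => regimeII A E ∧ E.IsStandard ∧ E.sing.Nonempty)
    {A : AmbientDatum p K} {E : IdealExponent A.Z} (hRg : regimeII A E) (hE : E.IsStandard) :
    ∃ (Z' : Scheme.{u}) (σ : Z' ⟶ A.Z) (J' : Z'.IdealSheafData),
      IsPermissibleLSB E.J E.b σ J' ∧ (⟨J', E.b⟩ : IdealExponent Z').sing = ∅ :=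
  exists_isPermissibleLSB_of_regimeII (terminatesNabla_of_terminatesWhole_of_nablaIrreducible hW hI)
    (nablaStepExists_of_nablaIrreducible hI) hC hRg hE

/-- **RUNG (ii), IRREDUCIBLE TERMINAL PLATS, FROM FOUR SHAPES of any string reading `σ`** (Eq. (127) over the centre off `∇′`,
`m′ ≤ m`, top stratum, monotonicity at singular points — no Eq. (128), no component measure): every standard regime-(ii)
state is resolved by an `E`-permissible LSB. [folklore] -/
theorem exists_isPermissibleLSB_of_regimeII_of_shapes_irred [PerfectField K] (σ : StringReading p K N)
    (hD : σ.DecreaseShape Rd regimeII) (hM : σ.StopsShape Rd regimeII) (hT : σ.TopSingShape Rd regimeII)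
    (hL : σ.MonotoneSingShape Rd regimeII) (hI : NablaIrreducibleII N Rd)
    (hC : ResumesCover N Rd fun A E => regimeII A E ∧ E.IsStandard ∧ E.sing.Nonempty)
    {A : AmbientDatum p K} {E : IdealExponent A.Z} (hRg : regimeII A E) (hE : E.IsStandard) :
    ∃ (Z' : Scheme.{u}) (σ' : Z' ⟶ A.Z) (J' : Z'.IdealSheafData),
      IsPermissibleLSB E.J E.b σ' J' ∧ (⟨J', E.b⟩ : IdealExponent Z').sing = ∅ :=
  exists_isPermissibleLSB_of_regimeII_irred (terminatesWholeII_of_shapes_sing N Rd σ hD hM hT hL) hI hC hRg hE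

end RungII

section Host

variable {k : Type u} [Field k] [CharP k p] {N : Notions.{u} n} {Rd : Reading p k N}

/-- **Γ-FREE ORDER REDUCTION FOR EVERY INPUT OF stmt-16156, IRREDUCIBLE TERMINAL PLATS** (four `σ`-shapes, irreducibility,
coverage — hypotheses about the résumés of the named `N` only; step existence is a kernel fact): for `k` perfect of
characteristic `p`, `X` integral regular locally of finite type quasi-compact over `k` with `topologicalKrullDim X ≤ 3`,
`I ≠ 0` effective Cartier and `m ≥ 1`, there is an `(I, m)`-permissible LSB `σ′ : Z′ → X` with last transform `J′` of order
`< m` at every point. 16156's `IsMarkedResolution` (boundary, snc) is neither used nor derived. [folklore] -/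
theorem exists_isPermissibleLSB_hostState_irred [PerfectField k] (σ : StringReading p k N)
    (hD : σ.DecreaseShape Rd regimeII) (hM : σ.StopsShape Rd regimeII) (hT : σ.TopSingShape Rd regimeII)
    (hL : σ.MonotoneSingShape Rd regimeII) (hI : NablaIrreducibleII N Rd)
    (hC : ResumesCover N Rd fun A E => regimeII A E ∧ E.IsStandard ∧ E.sing.Nonempty) (X : Scheme.{u})
    (s : X ⟶ Spec (.of k)) [LocallyOfFiniteType s] [QuasiCompact s] [IsIntegral X] (hreg : Scheme.IsRegular X)
    (hdim : topologicalKrullDim X ≤ 3) (I : X.IdealSheafData) (hI0 : I ≠ ⊥) (hIc : IsEffectiveCartier I) (m : ℕ)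
    (hm : 1 ≤ m) :
    ∃ (Z' : Scheme.{u}) (σ' : Z' ⟶ X) (J' : Z'.IdealSheafData),
      IsPermissibleLSB I m σ' J' ∧ ∀ x : Z', idealOrder J' x < m :=
  exists_isPermissibleLSB_hostState
    (terminatesNabla_of_terminatesWhole_of_nablaIrreducible (terminatesWholeII_of_shapes_sing N Rd σ hD hM hT hL) hI)
    (nablaStepExists_of_nablaIrreducible hI) hC X s hreg hdim I hI0 hIc m hm

end Host

end CampaignW46

end Summit.ResolutionOfSingularities.ResolutionOfSingularities.Theorems

end
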